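import Summits.HodgeConjecture.HodgeConjecture.Theorems.F0P3cStCharTSFilteredNewtonHaar   -- ★ (C1b) p851823: `map_measure_image_eq_of_linearNewton`, `injOn_of_linearNewton`, `image_vadd_eq_of_linearNewton`
import Literature.MeasureTheory.Group.LocalFieldLinearJacobian                             -- ★ (C6) LH10-p01: `measure_image_eq_addEquivAddHaarChar_mul`, `measure_preimage_eq_addEquivAddHaarChar_inv_mul`
import HarnessLib

/-!
# F0 · P3c · line LH6 «StCharTS» — WIF antecedent, ELLIPTIC half: brick (C8a) «TUBE MEASURE FROM CHART DATA» — the measure of a tube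
# `g₀ · c(Θ(A))` is `(ν K ∕ μ Λ) · χ(L) · μ(A)` when `Θ` is a Newton map with linear part `L` and the chart `c` carries additive Haar measure to Haar measure

Cell `pub/hodgecm-mathlib`, crux H413 = `stmt-HodgeConjecture-24833` (lane `--supports … --as helper`), route HCCMUnconditional; seat LH5-p02 (g6); ROAD «JAC-ELL» v0
(`F0/P3c/LH5/LH5-p02/g6/ROAD-JAC-ELL.v0.LH5p02g6.md`) brick C8a = the model-free junction of the assembly C8.  THEOREMS ONLY; Mathlib + ★ (C1b) + ★ (C6).

SETTING.  `V` a filtered abelian group as in ★ (C1) (`Λ` antitone, open, `Λ k` compact, neighbourhood basis of `0`; Hausdorff, second countable, Borel, locally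
compact) with an additive Haar measure `μ` (regular: second countable + locally compact); a Newton map `Θ : V → V` with linear part `L : V ≃ₜ+ V` — hypothesis `(N_L)` of ★ (C1) at depth `k`, `Θ`
continuous on `Λ k`, `L⁻¹ (Θ 0) ∈ Λ k`; a group `G` with a left-invariant measure `ν` and a chart `c : V → G` carrying `μ` to `ν` on a window in the CONSEQUENCE form of
★ (C3)∕(C4): `hchart : ∀ B ⊆ S, MeasurableSet (c '' B) → κ * ν (c '' B) = μ B` on a set `S ⊇ Θ '' Λ k` (`κ = μ Λ₀ ∕ ν K` there).

THE RESULTS (all PROVED).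
* `measure_image_newton_eq` — **`μ (Θ '' A) = χ(L) · μ A`** for `A ⊆ Λ k` with Borel image, `χ = addEquivAddHaarChar` (Mathlib's Haar character; ★ (C6)
  `addEquivAddHaarChar_continuousLinearEquiv_of_trivialization` evaluates it as `mod_F(det L)` for an `F`-linear `L` on a finite-dimensional `F`-space):
  ★ (C1b) `(μ.map L)(Θ '' A) = μ A` + ★ (C6) `μ (L ⁻¹' X) = χ(L)⁻¹ μ X`.
* **`tube_measure_eq`** — `κ · ν (g₀ • c '' (Θ '' A)) = χ(L) · μ A` (left invariance of `ν` + `hchart` + the above): THE TUBE-JACOBIAN IDENTITY IN CHART FORM.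
  On the road: `V = 𝔲(J)` with the sub-box `Λ = 𝔪_· ⊕ 𝔱_·`, `Θ(X, Y) = S(Ad(t₀⁻¹)X, S(Y, −X))` (★ C5), `L = (Ad t₀⁻¹ − 1) ∘ pr_𝔪 + pr_𝔱`, `g₀ = t₀`, `c` = Cayley (★ C4),
  `χ(L) = |det((Ad t₀⁻¹ − 1)|_𝔪)|_v = (𝔇.DG t₀)²` (C6 + C7); the quotient-measure and index bookkeeping that turn `μ A` into `μ₀(A₀)·tm(V)` are C8b.

HONEST LABEL: HC_CM is proved only modulo the 7 printed citations (2 remaining named inputs: hLiu418 = `stmt-HodgeConjecture-24832`, h413 =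
`stmt-HodgeConjecture-24833`) until rung 0 closes; this file closes no organ (count-neutral bank for the elliptic half of the WIF antecedent of RUNG0).

## References
* [HarishChandra1970] Harish-Chandra (notes by G. van Dijk), *Harmonic Analysis on Reductive p-adic Groups*, LNM 162 (1970), Lemma 22 (the tube Jacobian
  `|det(Ad(γ⁻¹) − 1)|` at a Cartan subgroup — the statement this junction serves). Context locator.
* [WeilBNT1967] A. Weil, *Basic Number Theory* (1967), Ch. I §2 (the module of an automorphism). Context locator.
-/

set_option autoImplicit false
set_option linter.dupNamespace false

open Set Filter MeasureTheory MeasureTheory.Measure TopologicalSpace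
open Summit.HodgeConjecture.HodgeConjecture.Cruxes.H413.F0P3cStCharTSFilteredNewton
open Summit.HodgeConjecture.HodgeConjecture.Cruxes.H413.F0P3cStCharTSFilteredNewtonHaar
open scoped Pointwise Topology ENNReal

namespace Summit.HodgeConjecture.HodgeConjecture.Cruxes.H413.F0P3cStCharTSTubeMeasureChart

section Newton

variable {V : Type*} [AddCommGroup V] [TopologicalSpace V] [IsTopologicalAddGroup V] [T2Space V] [SecondCountableTopology V]
  [LocallyCompactSpace V] [MeasurableSpace V] [BorelSpace V]
  (Λ : ℕ → AddSubgroup V) {k : ℕ} (Θ : V → V) (L : V ≃ₜ+ V)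
  (μ : Measure V) [μ.IsAddHaarMeasure]

/-- **`μ (Θ '' A) = χ(L) · μ A`**: a Newton map with linear part `L` scales the Haar measure of subsets of the base box exactly as `L` does.
[cite: WeilBNT1967, Ch. I §2] [cite: HarishChandra1970, Lemma 22] -/
theorem measure_image_newton_eq (hanti : Antitone Λ) (hopen : ∀ j, IsOpen (Λ j : Set V))
    (hcomp : IsCompact (Λ k : Set V)) (hbasis : ∀ U ∈ 𝓝 (0 : V), ∃ j, (Λ j : Set V) ⊆ U)
    (hΘ : ContinuousOn Θ (Λ k : Set V))
    (hN : ∀ j, k ≤ j → ∀ x ∈ Λ k, ∀ y ∈ Λ j, Θ (x + y) - Θ x - L y ∈ L '' (Λ (j + 1) : Set V))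
    (h0 : L.symm (Θ 0) ∈ Λ k) {A : Set V} (hA : A ⊆ (Λ k : Set V)) (hAm : MeasurableSet (Θ '' A)) :
    μ (Θ '' A) = addEquivAddHaarChar L * μ A := by
  have key := map_measure_image_eq_of_linearNewton Λ Θ L μ hanti hopen hcomp hbasis hΘ hN h0 hA hAm
  rw [Measure.map_apply (map_continuous L).measurable hAm,
    Literature.MeasureTheory.Group.measure_preimage_eq_addEquivAddHaarChar_inv_mul μ L (Θ '' A),
    ENNReal.coe_inv (addEquivAddHaarChar_pos L).ne'] at key
  have hχ : (addEquivAddHaarChar L : ℝ≥0∞) ≠ 0 := ENNReal.coe_ne_zero.2 (addEquivAddHaarChar_pos L).ne'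
  have hχ' : (addEquivAddHaarChar L : ℝ≥0∞) ≠ ∞ := ENNReal.coe_ne_top
  calc μ (Θ '' A) = addEquivAddHaarChar L * ((addEquivAddHaarChar L : ℝ≥0∞)⁻¹ * μ (Θ '' A)) := by
        rw [← mul_assoc, ENNReal.mul_inv_cancel hχ hχ', one_mul]
    _ = addEquivAddHaarChar L * μ A := by rw [key]

omit [SecondCountableTopology V] [LocallyCompactSpace V] [MeasurableSpace V] [BorelSpace V] in
/-- The image of the base box under a Newton map: `Θ '' Λ k = Θ 0 + L '' Λ k`. [cite: HarishChandra1970, Lemma 22] -/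
theorem image_coe_newton_eq (hanti : Antitone Λ) (hopen : ∀ j, IsOpen (Λ j : Set V))
    (hcomp : IsCompact (Λ k : Set V)) (hbasis : ∀ U ∈ 𝓝 (0 : V), ∃ j, (Λ j : Set V) ⊆ U)
    (hΘ : ContinuousOn Θ (Λ k : Set V))
    (hN : ∀ j, k ≤ j → ∀ x ∈ Λ k, ∀ y ∈ Λ j, Θ (x + y) - Θ x - L y ∈ L '' (Λ (j + 1) : Set V)) :
    Θ '' (Λ k : Set V) = Θ 0 +ᵥ L '' (Λ k : Set V) := by
  have h := image_vadd_eq_of_linearNewton Λ Θ L hanti hopen hcomp hbasis hΘ hN le_rfl (zero_mem (Λ k))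
  rwa [zero_vadd] at h

end Newton

section Tube

variable {V : Type*} [AddCommGroup V] [TopologicalSpace V] [IsTopologicalAddGroup V] [T2Space V] [SecondCountableTopology V]
  [LocallyCompactSpace V] [MeasurableSpace V] [BorelSpace V]
  {G : Type*} [Group G] [MeasurableSpace G]
  (Λ : ℕ → AddSubgroup V) {k : ℕ} (Θ : V → V) (L : V ≃ₜ+ V)
  (μ : Measure V) [μ.IsAddHaarMeasure]
  (c : V → G) (ν : Measure G) [ν.IsMulLeftInvariant]

/-- **THE TUBE-JACOBIAN IDENTITY IN CHART FORM**: if the chart `c` carries `μ` to `κ⁻¹ • ν` on a set `S` containing `Θ '' Λ k` (★ (C3)∕(C4) supply this with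
`S` the chart box and `κ = μ Λ₀ ∕ ν K`), then for every `A ⊆ Λ k` whose images are Borel, `κ · ν (g₀ • c '' (Θ '' A)) = χ(L) · μ A`.
[cite: HarishChandra1970, Lemma 22] [cite: WeilBNT1967, Ch. I §2] -/
theorem tube_measure_eq (hanti : Antitone Λ) (hopen : ∀ j, IsOpen (Λ j : Set V))
    (hcomp : IsCompact (Λ k : Set V)) (hbasis : ∀ U ∈ 𝓝 (0 : V), ∃ j, (Λ j : Set V) ⊆ U)
    (hΘ : ContinuousOn Θ (Λ k : Set V))
    (hN : ∀ j, k ≤ j → ∀ x ∈ Λ k, ∀ y ∈ Λ j, Θ (x + y) - Θ x - L y ∈ L '' (Λ (j + 1) : Set V))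
    (h0 : L.symm (Θ 0) ∈ Λ k)
    {S : Set V} (hS : Θ '' (Λ k : Set V) ⊆ S) {κ : ℝ≥0∞}
    (hchart : ∀ B ⊆ S, MeasurableSet (c '' B) → κ * ν (c '' B) = μ B)
    (g₀ : G) {A : Set V} (hA : A ⊆ (Λ k : Set V)) (hAm : MeasurableSet (Θ '' A)) (hAcm : MeasurableSet (c '' (Θ '' A))) :
    κ * ν (g₀ • (c '' (Θ '' A))) = addEquivAddHaarChar L * μ A := by
  rw [measure_smul, hchart _ ((image_mono hA).trans hS) hAcm,
    measure_image_newton_eq Λ Θ L μ hanti hopen hcomp hbasis hΘ hN h0 hA hAm]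

end Tube

end Summit.HodgeConjecture.HodgeConjecture.Cruxes.H413.F0P3cStCharTSTubeMeasureChart
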